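import Mathlib

/-!
# BridgeTrace — the period functional on the Weil line is a trace form; sharp Galois collapse (Tier 4)

Seat p4 of the blind cell pub-hodge-repro2 (README §6, T4-A). Complement to `BridgeCore` §4
(route/TIER3.md §6 item 16 (α)): the pairing `w ↦ ⟨f_*[S], w⟩` restricted to the split Weil line
`W_𝐅(B)` is a ℚ-linear functional on a 1-dimensional `𝐅`-vector space, i.e. (after choosing a
generator `w₀`, `λ ↦ λ • w₀`) a ℚ-linear functional `φ` on the number field `𝐅` itself. Kernel-checked
here, with no geometry:

* `exists_trace_mul_eq`: every ℚ-linear functional on a number field `F` is `x ↦ Tr_{F/ℚ}(c x)` for a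
  unique `c ∈ F` (non-degeneracy of the trace form);
* `trace_mul_eq_sum_embeddings`: over `ℂ`, `Tr_{F/ℚ}(c x) = ∑_σ σ(c) σ(x)` over the `[F:ℚ]` complex
  embeddings — the eigen-period expansion `⟨f_*[S], λ • w₀⟩ = ∑_j τ_j(λ) a_j` with `a_j = τ_j(c)`;
* `ne_zero_iff_forall_embedding_ne_zero` (SHARP GALOIS COLLAPSE): `φ ≠ 0 ↔ c ≠ 0 ↔ every σ(c) ≠ 0`:
  the complex eigen-periods of a RATIONAL period functional are all zero or all non-zero, so «which
  Galois conjugate one takes is immaterial» (item 16 (α)) is a theorem, not a convention.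
-/

namespace Summit.Ventures.HodgeRepro2.BridgeTrace

variable {F : Type*} [Field F] [NumberField F]

/-- **Trace representative.** Every ℚ-linear functional `φ` on a number field `F` is of the form
`x ↦ Tr_{F/ℚ}(c x)` for some `c ∈ F` (the trace form is non-degenerate). -/
theorem exists_trace_mul_eq (φ : Module.Dual ℚ F) :
    ∃ c : F, ∀ x : F, Algebra.trace ℚ F (c * x) = φ x := by
  have hnd := traceForm_nondegenerate ℚ F
  refine ⟨(LinearMap.BilinForm.toDual _ hnd).symm φ, fun x => ?_⟩
  rw [← Algebra.traceForm_apply, ← LinearMap.BilinForm.toDual_def hnd,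
    LinearEquiv.apply_symm_apply]

/-- The trace representative is unique. -/
theorem eq_of_forall_trace_mul_eq {c c' : F}
    (h : ∀ x : F, Algebra.trace ℚ F (c * x) = Algebra.trace ℚ F (c' * x)) : c = c' := by
  have hnd := traceForm_nondegenerate ℚ F
  rw [← sub_eq_zero]
  apply hnd.1 (c - c')
  intro x
  rw [Algebra.traceForm_apply, sub_mul, map_sub, h x, sub_self]

/-- The trace representative of the zero functional is `0`. -/
theorem eq_zero_of_forall_trace_mul_eq_zero {c : F} (h : ∀ x : F, Algebra.trace ℚ F (c * x) = 0) :
    c = 0 :=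
  eq_of_forall_trace_mul_eq (c' := 0) (fun x => by rw [h x, zero_mul, map_zero])

/-- **Eigen-period expansion.** Over `ℂ`, `Tr_{F/ℚ}(c x) = ∑_σ σ(c) σ(x)`, the sum over the complex
embeddings `σ : F →ₐ[ℚ] ℂ` (Mathlib's `trace_eq_sum_embeddings`). -/
theorem trace_mul_eq_sum_embeddings (c x : F) :
    ((Algebra.trace ℚ F (c * x) : ℚ) : ℂ) = ∑ σ : F →ₐ[ℚ] ℂ, σ c * σ x := by
  have h := trace_eq_sum_embeddings (K := ℚ) (L := F) ℂ (x := c * x)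
  rw [eq_ratCast] at h
  rw [h]
  exact Finset.sum_congr rfl (fun σ _ => map_mul σ c x)

/-- A ℚ-linear functional `φ = Tr(c ·)` vanishes iff its trace representative vanishes. -/
theorem eq_zero_iff_trace_rep_eq_zero (φ : Module.Dual ℚ F) (c : F)
    (hc : ∀ x : F, Algebra.trace ℚ F (c * x) = φ x) : φ = 0 ↔ c = 0 := by
  constructor
  · intro hφ
    apply eq_zero_of_forall_trace_mul_eq_zero
    intro x
    rw [hc x, hφ]
    rfl
  · intro hc0
    ext x
    rw [← hc x, hc0, zero_mul, map_zero]
    rfl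

/-- There is at least one complex embedding of a number field (`[F:ℚ] ≥ 1`). -/
theorem nonempty_algHom_complex : Nonempty (F →ₐ[ℚ] ℂ) := by
  have h : 0 < Fintype.card (F →ₐ[ℚ] ℂ) := by
    rw [AlgHom.card ℚ F ℂ]
    exact Module.finrank_pos
  exact Fintype.card_pos_iff.1 h

/-- **Sharp Galois collapse.** For a ℚ-linear functional `φ` on the number field `F` with trace
representative `c` (`φ x = Tr(c x)`): `φ ≠ 0` iff EVERY complex embedding `σ` has `σ c ≠ 0` — the
eigen-periods `a_σ = σ(c)` of a rational period functional are all zero or all non-zero. -/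
theorem ne_zero_iff_forall_embedding_ne_zero (φ : Module.Dual ℚ F) (c : F)
    (hc : ∀ x : F, Algebra.trace ℚ F (c * x) = φ x) :
    φ ≠ 0 ↔ ∀ σ : F →ₐ[ℚ] ℂ, σ c ≠ 0 := by
  rw [Ne, eq_zero_iff_trace_rep_eq_zero φ c hc]
  constructor
  · intro hc0 σ hσ
    exact hc0 ((map_eq_zero σ).1 hσ)
  · intro h hc0
    obtain ⟨σ⟩ := (nonempty_algHom_complex (F := F))
    exact h σ (by rw [hc0, map_zero])

/-- The same, in the form used by the bridge: SOME eigen-period is non-zero iff ALL are. -/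
theorem exists_embedding_ne_zero_iff_forall (c : F) :
    (∃ σ : F →ₐ[ℚ] ℂ, σ c ≠ 0) ↔ ∀ σ : F →ₐ[ℚ] ℂ, σ c ≠ 0 := by
  constructor
  · rintro ⟨σ, hσ⟩ σ' hσ'
    exact hσ (by rw [(map_eq_zero σ').1 hσ', map_zero])
  · intro h
    obtain ⟨σ⟩ := (nonempty_algHom_complex (F := F))
    exact ⟨σ, h σ⟩

/-- **Eigen-period expansion of a rational functional**: `φ x = ∑_σ σ(c) σ(x)` in `ℂ`, with
`a_σ := σ(c)`; hence (`BridgeCore.exists_sum_ne_zero_iff`) `φ ≠ 0` iff some `a_σ ≠ 0`, and by the sharp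
collapse iff all `a_σ ≠ 0`. -/
theorem dual_apply_eq_sum_embeddings (φ : Module.Dual ℚ F) (c : F)
    (hc : ∀ x : F, Algebra.trace ℚ F (c * x) = φ x) (x : F) :
    ((φ x : ℚ) : ℂ) = ∑ σ : F →ₐ[ℚ] ℂ, σ c * σ x := by
  rw [← hc x, trace_mul_eq_sum_embeddings]

end Summit.Ventures.HodgeRepro2.BridgeTrace
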